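import Summits.HodgeConjecture.HodgeConjecture.Theses.EightfoldBlochSeeds
import Summits.HodgeConjecture.HodgeConjecture.Theorems.BlochSeedDiscThreeLiftableDoor
import HarnessLib

/-!
# Crux `BlochSeedDiscThree` (`HasHyperbolicBlochSeed 4 3`) — the SEED DOOR through Schoen's explicit cycles, and its price

§0 BEARS ON H2 — crux item `stmt-HodgeConjecture-18882` of route «EightfoldBlochSeeds»,
`BlochSeedDiscThree := HasHyperbolicBlochSeed 4 3` (the `d = 3` seed feeding Door A at `(4, 3)`), POSITIVELY:
the file states in the kernel what the «literature road» (Schoen 1988 §2–3 / 1998: EXPLICIT curve-built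
fourfolds `F_c` with a Weil component on a `√-3`-Prym eightfold) must deliver to close the crux BY NAME, and what
that delivery costs against the cell's rigidity conjecture (Rʰ) (`BlochSeedDiscThreeSchoenRigidity.lean`).

## What is here (all sorry-free; binder logic over the landed frame, no new definition)

* `exists_coheight_eq_and_specializes` — bookkeeping: for an INTEGRAL closed `Z ⊂ X` of codimension exactly `p`
  every point of the image (read in any chart `X ≅ X₁`) is a specialisation of a point of codimension `p`; this
  DISCHARGES the purity side condition `hpure` that the landed door theorem `schoenCycle_not_blochSemiregular`
  carries as a hypothesis (referee §J n-ii) — for Schoen cycles it follows from `SchoenCycleAt` (`pure_of_schoenCycleAt`).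
* `blochSeedDiscThree_of_hasBlochSeedAt` — the introduction rule of the crux BY NAME: a hyperbolically polarised
  rational `√-3`-frame `(P, ψ₀, e, a)` of dimension `8`, a non-zero rational Weil class `w`, and a Bloch seed for
  `q·h_K⁴ + w` give `EightfoldBlochSeeds.BlochSeedDiscThree`.
* `blochSeedDiscThree_of_semiregular_schoenCycle` — THE SEED DOOR: on Schoen's frame `B₁ = im f` (hyperbolic,
  rational), a Schoen cycle `(Z, κ)` (`SchoenCycleAt`: integral, codimension exactly `4`, class line through
  `q·h_K⁴ + w`, `w ≠ 0` rational Weil) that is a regular immersion of codimension `4` (l.c.i.) AND Bloch-semiregular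
  in `B₁` closes the crux. These two deformation-theoretic properties of ONE explicit fourfold are EXACTLY the
  residual of the literature road; neither is in print (Schoen proves algebraicity of the Weil plane, not
  semiregularity; Bloch 1972 Remark (7.5): semiregular representatives in codimension `> 1` are «wide open»).
* `liftsAlongWeilFamilies_of_isBlochSemiregular` — Bloch's theorem in the frame's currency: a semiregular l.c.i.
  integral `Z ⊂ P` of codimension exactly `p` lifts along every Weil family keeping its class Hodge
  (`LiftsAlongWeilFamilies`), granting `Bloch1972_semiregularSubschemeLifts`.
* `hasLocallyAlgebraicWeilAnchor_of_semiregular_schoenCycle` — the same seed also delivers Door A's local input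
  `HasLocallyAlgebraicWeilAnchor 4 3` through DOOR L (trust base Bloch 1972 + Fulton 1998 named facts), i.e. without
  the class-level fact `BlochSemiregularSpread 8 4` used by the route's own arrow.
* `not_schoenRigidityHyp_of_semiregular_schoenCycle` — THE PRICE: a semiregular l.c.i. Schoen cycle on a PINNED
  frame (`CM48Datum ∧ CMTypeIsPhi5`, `ψ₀ = (2s¹⁶+1)|_{B₁}`) REFUTES (Rʰ). So closing the crux through Schoen's
  explicit cycles is the same task as refuting the cell's rigidity conjecture at an l.c.i. `F_c`
  (gap (R¹)/(R♭₁) = D4-EXACT of memo ROUND-3-CLOSEOUT-g7 §2), not a literature look-up.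
* `schoenCycle_not_blochSemiregular_of_schoenRigidityHyp` — conversely, under (Rʰ) and Bloch's theorem no l.c.i.
  Schoen cycle on a hyperbolically polarised rational pinned frame is Bloch-semiregular (the landed door theorem
  with (R) weakened to (Rʰ) — the only frames a seed can use — and `hpure` discharged).

HONEST LABEL. Nothing here decides the crux, (R) or (Rʰ). The theorems use no content of `IsNormBuilt`,
`CM48Datum` or `CMTypeIsPhi5` beyond instantiating (Rʰ). What the literature gives UNCONDITIONALLY at `K = ℚ(√-3)`
is already in the tree and is NOT the crux: split sixfolds (`Schoen1998_weilClasses_algebraic_hyperbolicSixfold_three`,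
`WeilTypeLadder.weilClasses_algebraic_of_prymOpen_family`), fourfolds of every discriminant, and the Weil plane of
every étale cyclic Prym (`Schoen1988_cyclicPrym_weilClasses_algebraic_degreeThree_allGenera`); the non-split
`√-3`-sixfolds the crux serves (via hyperbolic eightfolds) are not in print (Markman, arXiv:2509.23403, Thm. 1.2 and §12).

Provenance: WIDTH-LEVER lane `hodge-schoen-18882-p2` (director-hodge g7 §A 2026-08-27T10:51:02Z); companions
`BlochSeedDiscThreeSchoenRigidity.lean` / `…LiftEngine.lean` / `…LiftableDoor.lean` (cell `hodge-schoen` round 3).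
Supports item `stmt-HodgeConjecture-18882` (`EightfoldBlochSeeds.BlochSeedDiscThree := HasHyperbolicBlochSeed 4 3`).

References: [cite: Schoen1988HodgeWeil, §2 (construction of Q, z_χ), Thm 2.0, Cor 3.1] [cite: Bloch1972Semiregularity,
Thm. (7.4), Remark (7.5)] [cite: BuchweitzFlenner2003, Thm. 5.2] [cite: Markman2025SurveySecant, Thm. 1.2, §12]
[cite: vanGeemen1994HodgeAV, 5.2–5.4, 6.12, 7.3].
-/

noncomputable section
set_option linter.dupNamespace false
open CategoryTheory CategoryTheory.Limits AlgebraicGeometry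
open Literature.AlgebraicGeometry Literature.AlgebraicGeometry.Motives
open Literature.AlgebraicGeometry.Deformation
open Literature.AlgebraicGeometry.HodgeTheory
open Literature.AlgebraicTopology.SingularHomology
open Summit.HodgeConjecture.HodgeConjecture.Theses.EightfoldBlochSeeds (BlochSeedDiscThree)

namespace Summit.HodgeConjecture.HodgeConjecture.Theorems.BlochSeedDiscThree

/-! ### Bookkeeping: purity of the image of an integral subscheme of codimension exactly `p` -/

/-- **Every point of the image of an INTEGRAL closed `Z ⊂ X` of codimension exactly `p` specialises from a point of
codimension `p`**, read in an arbitrary chart `e : X ≅ X₁` (the shape of the side condition `hpure` of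
`not_isBlochSemiregular_of_rigidObstructed`). From `range_subset_closure_of_coheight_eq` (the image is the closure
of any of its codimension-`p` points) and the invariance of coheight under isomorphisms.
[folklore: EGA IV₂ §5.1; Hartshorne II Ex. 3.20] -/
theorem exists_coheight_eq_and_specializes {X : SchemeOver ℂ} {Z : Scheme.{0}} (κ : Z ⟶ X.left)
    [IsClosedImmersion κ] [AlgebraicGeometry.IsIntegral Z] {p : ℕ}
    (hcoh : ∀ z ∈ Set.range κ.base, (p : ℕ∞) ≤ Order.coheight z)
    (hcohp : ∃ z : Z, Order.coheight (κ.base z) = (p : ℕ∞)) (X₁ : SchemeOver ℂ) (e : X ≅ X₁) (z : Z) :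
    ∃ z' : Z, Order.coheight ((κ ≫ e.hom.left).base z') = (p : ℕ∞) ∧
      (κ ≫ e.hom.left).base z' ⤳ (κ ≫ e.hom.left).base z := by
  obtain ⟨z', hz'⟩ := hcohp
  have hcoh' : ∀ x : Z, (p : ℕ∞) ≤ Order.coheight (κ.base x) := fun x => hcoh _ ⟨x, rfl⟩
  have hsp : κ.base z' ⤳ κ.base z :=
    specializes_iff_mem_closure.2 (range_subset_closure_of_coheight_eq κ hcoh' ⟨z', hz'⟩ z' hz' ⟨z, rfl⟩)
  refine ⟨z', ?_, ?_⟩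
  · rw [Scheme.Hom.comp_apply, coheight_left_base_eq_of_iso e, hz']
  · rw [Scheme.Hom.comp_apply, Scheme.Hom.comp_apply]
    exact hsp.map e.hom.left.continuous

/-- **Schoen cycles are pure**: the side condition `hpure` of the landed door theorem
`schoenCycle_not_blochSemiregular` follows from `SchoenCycleAt` (integral, codimension exactly `4`).
[cite: Schoen1988HodgeWeil, Thm 2.0 (the cycles F_c are images of irreducible fourfolds)] -/
theorem pure_of_schoenCycleAt {C : SchemeOver ℂ} {𝒥 : Jacobian C} {σ : C ⟶ C} {f : 𝒥.J ⟶ 𝒥.J}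
    {ψ₀ : AbelianVariety.image f ⟶ AbelianVariety.image f} {e : ProjectiveEmbedding (AbelianVariety.image f).X}
    {a : complexBetti (projectiveSpace e.n ℂ) 2}
    {Z : Scheme.{0}} {κ : Z ⟶ (AbelianVariety.image f).X.left} (hZ : SchoenCycleAt C 𝒥 σ f ψ₀ e a Z κ) :
    ∀ (X₁ : SchemeOver ℂ) (e₁ : (AbelianVariety.image f).X ≅ X₁) (z : Z), ∃ z' : Z,
      Order.coheight ((κ ≫ e₁.hom.left).base z') = (4 : ℕ∞) ∧
        (κ ≫ e₁.hom.left).base z' ⤳ (κ ≫ e₁.hom.left).base z := by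
  obtain ⟨hκ, hint, hcoh, hcohp, -⟩ := hZ
  haveI := hκ
  haveI := hint
  exact exists_coheight_eq_and_specializes κ (p := 4) hcoh hcohp

/-! ### The seed door: the crux by name from a Bloch seed on a hyperbolically polarised `√-3`-frame -/

/-- **Introduction rule of the crux BY NAME.** A complex abelian eightfold `P` with `ψ₀ ≫ ψ₀ = -3`, a projective
embedding `e` and a rational `a ≠ 0` with `(P, ψ₀)` hyperbolic for `h_K = 3·e^*a + ψ₀^*e^*a`, a non-zero rational
class `w` of the Weil plane `weilClassesOf P ψ₀ 4 3`, and a Bloch seed for some `q·h_K⁴ + w` (`HasBlochSeedAt`)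
give `EightfoldBlochSeeds.BlochSeedDiscThree` (`= HasHyperbolicBlochSeed 4 3`, unfolded). Every object-level lane
for this crux ends in this rule. [cite: Bloch1972Semiregularity, Remark (7.5)] -/
theorem blochSeedDiscThree_of_hasBlochSeedAt {P : AbelianVariety ℂ} {ψ₀ : P ⟶ P}
    {e : ProjectiveEmbedding P.X} {a : complexBetti (projectiveSpace e.n ℂ) 2}
    {w : complexBetti P.X (2 * 4)} (hdim : P.dim = 2 * 4) (hψ : ψ₀ ≫ ψ₀ = -((3 : ℕ) • 𝟙 P))
    (ha : IsRationalClass a) (ha0 : a ≠ 0) (hhyp : IsHyperbolicWeilType P ψ₀ 4 (hK ψ₀ e a))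
    (hwW : w ∈ weilClassesOf P ψ₀ 4 3) (hwrat : IsRationalClass w) (hw0 : w ≠ 0)
    (hseed : HasBlochSeedAt 4 P (hK ψ₀ e a) w) : BlochSeedDiscThree :=
  show HasHyperbolicBlochSeed 4 3 from ⟨P, ψ₀, e, a, w, hdim, hψ, ha, ha0, hhyp, hwW, hwrat, hw0, hseed⟩

/-- **THE SEED DOOR through Schoen's explicit cycles.** On Schoen's frame `B₁ = im f` with `√-3`-multiplication
`ψ₀` (`ψ₀ ≫ ψ₀ = -3`, `dim B₁ = 8`), polarised by a RATIONAL `a ≠ 0` with `(B₁, ψ₀)` HYPERBOLIC for `h_K` (met for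
Schoen's `B₁`: census R2, `h_K = E_B`, `disc W_K ≡ (−1)⁴`), a Schoen cycle `(Z, κ)` — integral, codimension exactly
`4`, class line through `q·h_K⁴ + w` with `w ≠ 0` a rational Weil class (`SchoenCycleAt`; Schoen's six `F_c`) —
which is moreover a REGULAR IMMERSION OF CODIMENSION `4` (l.c.i.) and BLOCH-SEMIREGULAR in `B₁` closes the crux
`BlochSeedDiscThree`. The curve-built clause `IsNormBuilt` is not used. [cite: Schoen1988HodgeWeil, Thm 2.0, §3]
[cite: Bloch1972Semiregularity, Thm. (7.4), Remark (7.5)] -/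
theorem blochSeedDiscThree_of_semiregular_schoenCycle
    {C : SchemeOver ℂ} {𝒥 : Jacobian C} {σ : C ⟶ C} {f : 𝒥.J ⟶ 𝒥.J}
    {ψ₀ : AbelianVariety.image f ⟶ AbelianVariety.image f} {e : ProjectiveEmbedding (AbelianVariety.image f).X}
    {a : complexBetti (projectiveSpace e.n ℂ) 2} (hdim : (AbelianVariety.image f).dim = 2 * 4)
    (hψ : ψ₀ ≫ ψ₀ = -((3 : ℕ) • 𝟙 (AbelianVariety.image f))) (ha : IsRationalClass a) (ha0 : a ≠ 0)
    (hhyp : IsHyperbolicWeilType (AbelianVariety.image f) ψ₀ 4 (hK ψ₀ e a))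
    {Z : Scheme.{0}} {κ : Z ⟶ (AbelianVariety.image f).X.left} (hZ : SchoenCycleAt C 𝒥 σ f ψ₀ e a Z κ)
    (hreg : IsRegularImmersionOfCodim κ 4) (hsr : IsBlochSemiregular κ (2 * 4) 4) : BlochSeedDiscThree := by
  obtain ⟨hκ, hint, hcoh, -, -, q, w, hwW, hwrat, hw0, hsupp⟩ := hZ
  exact blochSeedDiscThree_of_hasBlochSeedAt hdim hψ ha ha0 hhyp hwW hwrat hw0
    ⟨Z, κ, q, hκ, hreg, hint, hcoh, hsr, hsupp⟩

/-! ### Bloch's theorem in the frame's currency, and Door A from the same seed -/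

/-- **Bloch (7.4) ⟹ a semiregular l.c.i. lifts along every Weil family.** Granting the tree's typed Bloch theorem
`Bloch1972_semiregularSubschemeLifts`, an INTEGRAL closed `Z ⊂ P` of codimension exactly `p` which is a regular
immersion of codimension `p` and Bloch-semiregular (`IsBlochSemiregular i n p`) satisfies
`LiftsAlongWeilFamilies n p d P Z i` for every `d` (pointwise negation of `WeilRigidObstructed`, via the landed
contrapositive `not_isBlochSemiregular_of_rigidObstructed`). [cite: Bloch1972Semiregularity, Thm. (7.4)]
[cite: Artin1969, Cor. (2.2)] -/
theorem liftsAlongWeilFamilies_of_isBlochSemiregular (hB : Bloch1972_semiregularSubschemeLifts) {n p d : ℕ}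
    {P : AbelianVariety ℂ} {Z : Scheme.{0}} {i : Z ⟶ P.X.left} [IsClosedImmersion i]
    [AlgebraicGeometry.IsIntegral Z] (hcoh : ∀ z ∈ Set.range i.base, (p : ℕ∞) ≤ Order.coheight z)
    (hcohp : ∃ z : Z, Order.coheight (i.base z) = (p : ℕ∞)) (hreg : IsRegularImmersionOfCodim i p)
    (hsr : IsBlochSemiregular i n p) : LiftsAlongWeilFamilies n p d P Z i :=
  liftsAlongWeilFamilies_iff_not_weilRigidObstructed.2 fun hW =>
    not_isBlochSemiregular_of_rigidObstructed hB (rigidObstructed_of_weilRigidObstructed hW) hreg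
      (exists_coheight_eq_and_specializes i hcoh hcohp) hsr

/-- **The same seed delivers Door A's local input through DOOR L.** A semiregular l.c.i. Schoen cycle on a
hyperbolically polarised rational frame gives `HasLocallyAlgebraicWeilAnchor 4 3` — the input the crux serves in
`EightfoldBlochSeeds.closes` — with trust base Bloch 1972 (object level) + Fulton 1998 (named facts
`Bloch1972_semiregularSubschemeLifts`, `fulton1998_flatFamily_cycleClass_specialises`) instead of the class-level
`BlochSemiregularSpread 8 4` of the route's own arrow `hasLocallyAlgebraicWeilAnchor_of_blochSpread_of_hyperbolicBlochSeed`.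
[cite: Bloch1972Semiregularity, Thm. (7.4)] [cite: BuchweitzFlenner2003, Thm. 5.2] -/
theorem hasLocallyAlgebraicWeilAnchor_of_semiregular_schoenCycle (hB : Bloch1972_semiregularSubschemeLifts)
    (hF : fulton1998_flatFamily_cycleClass_specialises)
    {C : SchemeOver ℂ} {𝒥 : Jacobian C} {σ : C ⟶ C} {f : 𝒥.J ⟶ 𝒥.J}
    {ψ₀ : AbelianVariety.image f ⟶ AbelianVariety.image f} {e : ProjectiveEmbedding (AbelianVariety.image f).X}
    {a : complexBetti (projectiveSpace e.n ℂ) 2} (hdim : (AbelianVariety.image f).dim = 2 * 4)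
    (hψ : ψ₀ ≫ ψ₀ = -((3 : ℕ) • 𝟙 (AbelianVariety.image f))) (ha : IsRationalClass a) (ha0 : a ≠ 0)
    (hhyp : IsHyperbolicWeilType (AbelianVariety.image f) ψ₀ 4 (hK ψ₀ e a))
    {Z : Scheme.{0}} {κ : Z ⟶ (AbelianVariety.image f).X.left} (hZ : SchoenCycleAt C 𝒥 σ f ψ₀ e a Z κ)
    (hreg : IsRegularImmersionOfCodim κ 4) (hsr : IsBlochSemiregular κ (2 * 4) 4) :
    HasLocallyAlgebraicWeilAnchor 4 3 := by
  obtain ⟨hκ, hint, hcoh, hcohp, -⟩ := id hZ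
  haveI := hκ
  haveI := hint
  exact hasLocallyAlgebraicWeilAnchor_of_liftable_schoenCycle hF hdim hψ ha ha0 hhyp hZ
    (liftsAlongWeilFamilies_of_isBlochSemiregular hB hcoh hcohp hreg hsr)

/-! ### The price: a semiregular Schoen cycle refutes (Rʰ); under (Rʰ) there is none -/

/-- **THE PRICE OF THE SEED DOOR.** On a PINNED Schoen frame (`CM48Datum C 𝒥 σ s f`, `CMTypeIsPhi5 𝒥 s`,
`ψ₀ = (2s¹⁶ + 1)|_{B₁}`, `dim B₁ = 8`, `ψ₀ ≫ ψ₀ = -3`) polarised by a rational `a ≠ 0` with `h_K` hyperbolic, an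
l.c.i. Schoen cycle that is Bloch-semiregular REFUTES the rigidity conjecture (Rʰ) `SchoenRigidityHyp`, granting
Bloch's theorem: (Rʰ) makes the cycle `WeilRigidObstructed 8 4 3`, and a rigid-obstructed l.c.i. is not semiregular
(`not_isBlochSemiregular_of_rigidObstructed`, purity discharged by `pure_of_schoenCycleAt`). So the literature road
«Schoen's explicit cycles as seeds» closes the crux exactly by refuting (Rʰ) at an l.c.i. `F_c`.
[cite: Bloch1972Semiregularity, Thm. (7.4)] [cite: Schoen1988HodgeWeil, Thm 2.0, §3] -/
theorem not_schoenRigidityHyp_of_semiregular_schoenCycle (hB : Bloch1972_semiregularSubschemeLifts)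
    (C : SchemeOver ℂ) (𝒥 : Jacobian C) (σ : C ⟶ C) (s f : 𝒥.J ⟶ 𝒥.J)
    (ψ₀ : AbelianVariety.image f ⟶ AbelianVariety.image f) (e : ProjectiveEmbedding (AbelianVariety.image f).X)
    (a : complexBetti (projectiveSpace e.n ℂ) 2) (hD : CM48Datum C 𝒥 σ s f) (h5 : CMTypeIsPhi5 𝒥 s)
    (hψι : ψ₀ ≫ AbelianVariety.imageι f = AbelianVariety.imageι f ≫ (2 • (End.of s ^ 16).asHom + 𝟙 𝒥.J))
    (hdim : (AbelianVariety.image f).dim = 2 * 4) (hψ : ψ₀ ≫ ψ₀ = -((3 : ℕ) • 𝟙 (AbelianVariety.image f)))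
    (ha : IsRationalClass a) (ha0 : a ≠ 0)
    (hhyp : IsHyperbolicWeilType (AbelianVariety.image f) ψ₀ 4 (hK ψ₀ e a))
    (Z : Scheme.{0}) (κ : Z ⟶ (AbelianVariety.image f).X.left) (hZ : SchoenCycleAt C 𝒥 σ f ψ₀ e a Z κ)
    (hreg : IsRegularImmersionOfCodim κ 4) (hsr : IsBlochSemiregular κ (2 * 4) 4) : ¬ SchoenRigidityHyp :=
  fun hR => not_isBlochSemiregular_of_rigidObstructed hB
    (rigidObstructed_of_weilRigidObstructed (hR C 𝒥 σ s f ψ₀ e a hD h5 hψι hdim hψ ha ha0 hhyp Z κ hZ))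
    hreg (pure_of_schoenCycleAt hZ) hsr

/-- **Under (Rʰ) no l.c.i. Schoen cycle on a hyperbolically polarised rational pinned frame is Bloch-semiregular**
— the landed door theorem `schoenCycle_not_blochSemiregular` with (R) weakened to (Rʰ) (the only frames on which a
seed can be used: `HasHyperbolicBlochSeed 4 3` asks for `a` rational, `a ≠ 0`, `h_K` hyperbolic) and the purity
hypothesis discharged. Contrapositive of `not_schoenRigidityHyp_of_semiregular_schoenCycle`.
[cite: Bloch1972Semiregularity, Thm. (7.4), Remark (7.5)] [cite: Schoen1988HodgeWeil, Thm 2.0] -/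
theorem schoenCycle_not_blochSemiregular_of_schoenRigidityHyp (hR : SchoenRigidityHyp)
    (hB : Bloch1972_semiregularSubschemeLifts)
    (C : SchemeOver ℂ) (𝒥 : Jacobian C) (σ : C ⟶ C) (s f : 𝒥.J ⟶ 𝒥.J)
    (ψ₀ : AbelianVariety.image f ⟶ AbelianVariety.image f) (e : ProjectiveEmbedding (AbelianVariety.image f).X)
    (a : complexBetti (projectiveSpace e.n ℂ) 2) (hD : CM48Datum C 𝒥 σ s f) (h5 : CMTypeIsPhi5 𝒥 s)
    (hψι : ψ₀ ≫ AbelianVariety.imageι f = AbelianVariety.imageι f ≫ (2 • (End.of s ^ 16).asHom + 𝟙 𝒥.J))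
    (hdim : (AbelianVariety.image f).dim = 2 * 4) (hψ : ψ₀ ≫ ψ₀ = -((3 : ℕ) • 𝟙 (AbelianVariety.image f)))
    (ha : IsRationalClass a) (ha0 : a ≠ 0)
    (hhyp : IsHyperbolicWeilType (AbelianVariety.image f) ψ₀ 4 (hK ψ₀ e a))
    (Z : Scheme.{0}) (κ : Z ⟶ (AbelianVariety.image f).X.left) (hZ : SchoenCycleAt C 𝒥 σ f ψ₀ e a Z κ)
    (hreg : IsRegularImmersionOfCodim κ 4) : ¬ IsBlochSemiregular κ (2 * 4) 4 :=
  fun hsr => not_schoenRigidityHyp_of_semiregular_schoenCycle hB C 𝒥 σ s f ψ₀ e a hD h5 hψι hdim hψ ha ha0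
    hhyp Z κ hZ hreg hsr hR

end Summit.HodgeConjecture.HodgeConjecture.Theorems.BlochSeedDiscThree

end
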